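import Summits.QuantumFields.YangMills.Theorems.BalabanUVNodesN22AtRecordOfKernelFadingSector
import Summits.QuantumFields.YangMills.Theorems.BalabanUVNodesN22AtRecordOfOutputCoordHoloPrinted
import Summits.QuantumFields.YangMills.Theorems.BalabanUVNodesN22KernelLimitOfTwoPointGeneratingLetters

/-!
# NODE N22 (NE9) — THE SECTOR EDITION OF K3's `h9` IN PRINT-LEVEL CURRENCY, and its (G≈)-keyed twin: node N18's kernel step rate + SECTOR holomorphy with quadratic vanishing at
# zero coupling in every young coupling (possibility 1 — NO disc through `g = 0`, NO `EHoloAt`) + the printed output bound (1.18) + PRINTED (2.38) + PRINTED configuration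
# analyticity `AnalyticH` ([II] p. 15) + holomorphic readings + p. 282 tails + W1-20's law + (1.21) ∕ (G≈) — dag-n22-c g15's J46 `ne9_EA_objectsOfRecord₁₃_of_kernelStepRate_sectorHolo`
# with its ONE structural non-print binder (term holomorphy through the readings) DISCHARGED by this lineage's p621851 §0, then its (1.21) letter by dag-n22-w3's p616912 §3

Cell `pub-ymgap`, Track A (HUMAN RULING D-0062), WIDTH SEAT `dag-n22-w5` (g2, harness re-seat of base w5) on node n22 = NE9, D-0154 (3a) second width wave;
`--kind proof --supports stmt-QuantumFields-27366 --as helper` (KEY MAP v2: K3⁸ `SpineGivenEndpointR13SepCoPHV`, skeleton v6 b4e55110ab73e679, whose §2b socket `h9` is K3⁷ v5's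
VERBATIM), COUNT-NEUTRAL; THEOREMS ONLY (0 `def`, 0 `sorry`, standard axioms).  CLAIM-2′ on the bus; dag-n22-c g15's WORD (a) (pub-ymgap INBOX 2026-08-28T13:43Z): «J46′ (the
print-level edition: `hEhol` by your p621851 §0, `hlim` by dag-n22-w3's p616912 §3) is YOURS the hour J46 lands — GO».
CONTEXT.  dag-n22-c g15's A6 SELF-FLAG (INBOX 13:20Z) on the kernel-fading producers J40 ∕ J42 ∕ J43 ∕ J44 — inherited by this lineage's print-level editions p628066
`…KernelFadingPrinted` and p634840 `…KernelFadingActivityMarginsPrinted`: their last-coupling (resp. older-coordinate) holomorphy binder asks ONE-radius closed discs about every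
`t ∈ ]0, γ]`, discs through ZERO coupling, located-vacuous for the term OF RECORD under the record's possibility-1 χ-species (thresholds `ε₁∕‖g‖`; coupling-blind inhabitants only —
rider 26′), exactly right under [I] p. 266's possibility 2.  The REPAIR of record is J45 (`…N22KernelFadingOfTermSecondDiff`, p638030: the road needs only SECOND DIFFERENCES of the
(2.13) terms in each young coupling, and `norm_secondDiff_le_of_sectorHolo` gets them UNIFORMLY from SECTOR holomorphy on the RELATIVE discs `closedBall s (c·s)`, `s ∈ ]0, γ]`, with the
CENTRED QUADRATIC bound `‖Ec z − V‖ ≤ B″ e^{−κ_E d} s²` — (2.13) p. 268 «vanishes at g_k = 0» + the `(g, B) ↦ (−g, −B)` parity) and J46 (`…N22AtRecordOfKernelFadingSector` §3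
`ne9_EA_objectsOfRecord₁₃_of_kernelStepRate_sectorHolo`: the SECTOR edition of `h9` at the record).  J46 §3 displays, besides the estimate rows and the data with owners, ONE structural
binder that is not at print's level — `hEhol`, holomorphy of the (2.13) TERM through the complexified CONFIGURATION reading `Φ K k X` on `U K k X ⊇ ball 0 r` (a ball in the probe-chart
space `Ec K k`, NOT a coupling disc — untouched by the flag).  This lineage's p621851 §0 `differentiableOn_E_comp_of_printedSlots` derives it from PRINTED (2.38) `Bound238` + Road 1's
numerals + PRINTED `AnalyticH` + holomorphic readings with dag-n22-w3's sub-polymer space clause on `U` (J30 v1.1's engine ∘ J32′ §1); J46's ball clause `hΦsp` is then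
`ball_mem_sp_of_spaceClause`.  §2 discharges the remaining existence letter `PolLimitsExistOfRecord₁₃ F N θ` by dag-n22-w3 g4's `polLimitsExistOfRecord₁₃_of_twoPointGenerating` (p616912
§3) from the SAME printed (2.38) + activity holomorphy through the SAME readings (the SAME printed `AnalyticH`, J32′ §1 `differentiableOn_H_comp_of_analyticH`) + the SAME tails + the
small∕near class `lo` + (G≈) — the p611990 → p619316 → p622968 pattern; numerals in p607522's strength (`0 < κ ≤ r₁`, `κ₀(64,8) ≤ κ∕4`).  One application each; nothing of J38–J46 ∕
p621851 ∕ p616912 ∕ J32′ is re-declared.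

WHAT.  §1 ★★★ `ne9_EA_objectsOfRecord₁₃_of_kernelStepRate_sectorHolo_analyticH` ∕ ★★★ `n22At_rateCarriers_of_kernels_pin_of_kernelStepRate_sectorHolo_analyticH` — K3's `h9`
`NE9 ((objectsOfRecord₁₃ F N θ ℓ).EA 0) (Window θ.γ) ℓ.κ ℓ.moduli` and the N22 pin face `N22At (rateCarriersOfRecord₁₃CoPH 𝔯 F θ hP g₀ os k).u3` (every `k`, under `hpin`) from:
`ℓ.Signs`, `0 < θ.γ`; node N18's `KernelStepRateOfRecord₁₃ F N θ κ₅ ℓ.θ₅ C₅` (`0 ≤ C₅`); W1-20's law `Localizes17OfRecord₁₃ F N θ S emb`; THE SECTOR DATUM `hLsec` (aperture `c > 0`,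
letter `B″ ≥ 0`, rate `κ_E`) on general space tables `sp`; the printed-type OUTPUT bound `hbd` ([I] (1.18) at level `k + 1` = node00-def-W1's `TermBound118` read through `termC_succ`;
letter `B`); PRINTED (2.38) `Bound238 (box θ.γ k) (sp K k) A R` and PRINTED `AnalyticH (box θ.γ k) (sp K k)` with Road 1's numerals (`0 ≤ A`, `0 ≤ r₁`, `r₁ + 128 log 162 + 2 ≤ R`,
`A·e^{5r₁+1}K₀(64,8)·9·64 ≤ 1`); HOLOMORPHIC complexified probe readings `Φ K k X` of the record's β-chart on open `U K k X ⊇ ball 0 r` (chart clause `hΦemb`, sub-polymer space clause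
`hΦsp` on `U`); site weights with the minimizer tails (`B₃`, `δ₀ > 0`: [I] p. 282); `2κ₀(64,8) ≤ κ ≤ κ_E`; `PolLimitsExistOfRecord₁₃ F N θ`; rows `δ₁ ≤ κ₅`, `0 < ℓ.ω`, `ℓ.θ₅ ≤ ℓ.ω²`,
`ℓ.κ ≤ δ₁`, `(4·(2C₅∕(1−ℓ.θ₅) + 2E₁)∕θ.γ + C₂·θ.γ∕2)∕ℓ.ω ≤ ℓ.C₉` with J46's constants (`M₂ = (6c²+32c+64)∕c²·B″` inside `C₂`).  NO term-holomorphy hypothesis displayed.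
§2 ★★★ `ne9_EA_objectsOfRecord₁₃_of_kernelStepRate_sectorHolo_analyticH_twoPointGenerating` ∕ ★★★ `n22At_rateCarriers_of_kernels_pin_of_kernelStepRate_sectorHolo_analyticH_twoPointGenerating`
— the same with `hlim` DISCHARGED: + the small∕near class `lo` with its threshold clause + the bidisc radius `0 < r₂`, `(2B₃+1) r₂ ≤ r` + (G≈) at rate `0 ≤ r₀ < 1`; numerals `0 < κ ≤ r₁`,
`κ₀(64,8) ≤ κ∕4`.  NO (1.21)-existence and NO term-holomorphy hypothesis displayed.
THE N22 ROW SENTENCE, possibility-1 currency, PRINT-LEVEL: «N18's kernel step rate + SECTOR holomorphy of the (2.13) terms in each young coupling with quadratic vanishing at zero coupling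
+ printed (1.18) + printed (2.38) + printed configuration analyticity + holomorphic minimizer readings + p. 282 tails + W1-20's law + (1.21) [resp. (G≈)] + letter rows ⇒ K3's `h9` ∕
`N22At` with the record's GEOMETRIC moduli, every run length» — no disc through `g = 0`, no `EHoloAt`.

HONEST FRAMING (binding).  Count-neutral COMPOSITION of landed theorems by name; NO estimate of Bałaban's is proved or asserted; every displayed input is a HYPOTHESIS with its
owner (N18's kernel step rate: node N18 ∕ the N18 desks — NE5 NOT PRINTED for d = 4; the sector datum: the cell's QUANTITATIVE reading of [I] p. 263 ∕ (2.12)–(2.13) p. 268 under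
possibility 1 — NOT a printed display; for the older coordinates the chart is born at the coordinate's creation step and propagated through the generator — NODE A ∕ N09 ∕ N10 ∕
def-W1; printed (1.18) ∕ (2.38) ∕ `AnalyticH`: N10 ∕ NODE A at the towers of record; readings + tails: NODE A ∕ N09; (G≈): NODE A ∕ def-W1 — the thermodynamic convergence near the
window of the local terms' generating functions, NOT typed here; law: NODE A ∕ N10 ∕ def-W1; (1.21): dag-n22-w3's road — in §2 it is REDUCED, not proved); nothing of the record is
constructed or claimed to meet them; N22 is NOT discharged (typed 28∕28 · discharged 5∕27 UNCHANGED); K3⁸ OPEN and NOT claimed (no stub of 27366 is touched); NE9 is NOT IN PRINT for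
d = 4; no count claim (the chair's single count line is the only count); no summit statement is proved by this seat; one finite 𝕋⁴ programme at fixed ε — R4 closes the CONDITIONAL
rung `BalabanLadder.UV` only; NOTHING about the continuum limit, ℝ⁴, infinite volume, OS axioms, a mass gap or the Clay problem is proved or claimed by any of this.  A5∕A6: the letter
rows are jointly satisfiable with `ℓ.Signs` (J42 §2 `exists_letterBlock_rows`); the kernel-fading road has dag-n22-w2's NON-DEGENERATE model (p627338); p616912 §4 inhabits the (G≈)
letter's hypotheses at the EMPTY towers (DEGENERATE, declared); the sector datum, the law, (G≈)'s subject at the record, `θ` and the reading OF RECORD are LOCATED hypotheses — the filing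
is LOCATED, not a discharge.  References (TYPES only, no cite tags on the Summit side): [I] = Bałaban, CMP 109 (1987) Thm 1 p. 259, (1.7) p. 261, §1 p. 263 with (1.18), (1.20)–(1.21)
p. 264, §2 p. 266, (2.12)–(2.13) p. 268, p. 282 (site-weight tails: the sentence after (4.4)), (5.10) p. 293; [II] = CMP 116 (1988) (2.13)–(2.14) pp. 14–15, p. 15 (analyticity
statement), Lemma 3 (2.38) p. 20, (2.41) p. 21; King, CMP 102 (1986) Lemma 4.5 (the N18 mechanism's print); [Chae1985] Ch. 15 (the (G≈) letter's model-theoretic reading).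
-/

noncomputable section

open Filter Topology Metric Set
open scoped BigOperators

namespace YMDAG.N22.AtRecordOfPrintedSlots

open Literature.MathematicalPhysics.QuantumFieldTheory.Balaban1983to89
open Literature.MathematicalPhysics.QuantumFieldTheory.Balaban1983to89.T4Continuum (T4Family ULoop)
open Literature.MathematicalPhysics.QuantumFieldTheory.Balaban1983to89.T4OutputRate (Window NE9)
open Literature.MathematicalPhysics.QuantumFieldTheory.Balaban1983to89.B12TreeDecay (K₀ kappa₀)
open Literature.MathematicalPhysics.QuantumFieldTheory.Balaban1983to89.B12Decay510 (delta1)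
open Literature.MathematicalPhysics.QuantumFieldTheory.Balaban1983to89.B12Decay510Window (K₁)
open Literature.MathematicalPhysics.QuantumFieldTheory.Balaban1983to89.B12Decay510Torus (distCT nearT)
open Literature.MathematicalPhysics.QuantumFieldTheory.Balaban1983to89.TreeLengthTorus (TPt torusTreeLen)
open Literature.MathematicalPhysics.QuantumFieldTheory.Balaban1983to89.Node00 (siteOfInt Stage13Params Stage13HParams U3Letters₁₁ MatA)
open Literature.MathematicalPhysics.QuantumFieldTheory.Balaban1983to89.Node00.Sect2 (domCount domSys CPair)
open Literature.MathematicalPhysics.QuantumFieldTheory.Balaban1983to89.Node00.LocalizedSum17 (ReadingMaps Localizes17OfRecord₁₃)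
open Literature.MathematicalPhysics.QuantumFieldTheory.Balaban1983to89.Node00.W1 (ClusterTower ClusterStep box)
open Literature.MathematicalPhysics.QuantumFieldTheory.Balaban1983to89.Node00.U3OfKernels (histPrefix objectsOfRecord₁₃)
open Literature.MathematicalPhysics.QuantumFieldTheory.Balaban1983to89.Node00.U3KernelLetters (KernelStepRateOfRecord₁₃ PolLimitsExistOfRecord₁₃)
open YMDAG.UVSplit (N22At RateReading₁₃CoPH rateCarriersOfRecord₁₃CoPH)
open YMDAG.N22.WindowedOfCouplingHolo (differentiableOn_H_comp_of_analyticH histPrefix_mem_box)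
open YMDAG.N22.AtKernels (n22At_rateCarriers_of_kernels_pin_of_ne9 polLimitsExistOfRecord₁₃_of_twoPointGenerating)
open YMDAG.N22.KernelFading (ne9_EA_objectsOfRecord₁₃_of_kernelStepRate_sectorHolo)

open scoped Matrix.Norms.L2Operator

variable (F : T4Family) (N : ℕ) [NeZero N]

/-! ## §1 The sector edition of `h9` and the N22 pin face with term holomorphy through the readings DISCHARGED from print's slots -/

open Classical in
/-- ★★★ **K3's `h9` WITH THE RECORD's GEOMETRIC MODULI — SECTOR EDITION, PRINT-LEVEL.**  J46 §3 `ne9_EA_objectsOfRecord₁₃_of_kernelStepRate_sectorHolo` with the term-holomorphy binder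
`hEhol` DISCHARGED by p621851 §0 `differentiableOn_E_comp_of_printedSlots` (PRINTED (2.38) + numerals + PRINTED `AnalyticH` + holomorphic readings with dag-n22-w3's sub-polymer clause on `U`)
and J46's ball clause read off by `ball_mem_sp_of_spaceClause`: `ℓ.Signs` + `0 < θ.γ` + node N18's `KernelStepRateOfRecord₁₃ F N θ κ₅ ℓ.θ₅ C₅` + law + the SECTOR datum `hLsec`
(relative closed discs `closedBall s (c·s)`, `s ∈ ]0, θ.γ]`, centred quadratic bound `B″ e^{−κ_E d} s²` — no disc through zero coupling) + the printed output bound `hbd` + `Bound238` ∕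
`AnalyticH` on the boxes + numerals + holomorphic readings + tails + `PolLimitsExistOfRecord₁₃ F N θ` + J46's rows ⟹ `NE9 ((objectsOfRecord₁₃ F N θ ℓ).EA 0) (Window θ.γ) ℓ.κ ℓ.moduli`.
LOCATED (hypothesis form); N22 NOT discharged. -/
theorem ne9_EA_objectsOfRecord₁₃_of_kernelStepRate_sectorHolo_analyticH (θ : Stage13Params F N) (ℓ : U3Letters₁₁) (hs : ℓ.Signs) (hγ : 0 < θ.γ)
    (hlim : PolLimitsExistOfRecord₁₃ F N θ) {κ₅ C₅ : ℝ} (hC₅ : 0 ≤ C₅) (h5 : KernelStepRateOfRecord₁₃ F N θ κ₅ ℓ.θ₅ C₅)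
    {𝔸 : Type*} [NormedRing 𝔸] [NormedAlgebra ℂ 𝔸] (m' : ℕ) (M : ℕ) [NeZero M] (hM : M = F.L ^ m')
    (S : (K : ℕ) → ClusterTower (F.P K) 𝔸 M) (emb : ReadingMaps F (MatA N) 𝔸) (hloc : Localizes17OfRecord₁₃ F N θ S emb)
    (sp : (K k : ℕ) → (domSys (F.P K) M (k + 1)).Dom → Set (CPair (F.P K) 𝔸))
    {κ κE δ₀ B₃ r c B'' B A R r₁ : ℝ} (hc : 0 < c) (hB'' : 0 ≤ B'')
    (hA : 0 ≤ A) (hr₁ : 0 ≤ r₁) (hrate : r₁ + 2 * (64 * Real.log 162) + 2 ≤ R) (hsmall : A * Real.exp (5 * r₁ + 1) * K₀ 64 8 * 9 * 64 ≤ 1)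
    (hκ₀ : kappa₀ (4 * 2 ^ 4) (2 * 4) ≤ κ / 2) (hδ₀ : 0 < δ₀) (hB₃ : 0 ≤ B₃) (hr : 0 < r) (hB : 0 ≤ B) (hκE : κ ≤ κE)
    (hLsec : ∀ (K k : ℕ) (i : Fin (k + 1)), ∀ g ∈ box θ.γ k, ∀ (X : (domSys (F.P K) M (k + 1)).Dom), ∀ φ ∈ sp K k X,
      ∃ (Ec : ℂ → ℂ) (O : Set ℂ) (Vc : ℂ), DifferentiableOn ℂ Ec O ∧ (∀ s ∈ Ioc (0 : ℝ) θ.γ, closedBall (s : ℂ) (c * s) ⊆ O) ∧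
        (∀ s ∈ Ioc (0 : ℝ) θ.γ, ∀ z ∈ closedBall (s : ℂ) (c * s), ‖Ec z - Vc‖ ≤ B'' * Real.exp (-(κE * (domSys (F.P K) M (k + 1)).dj X)) * s ^ 2) ∧
        (∀ t ∈ Ioc (0 : ℝ) θ.γ, Ec t = ((S K) k).E (Function.update g i t) φ X))
    (hbd : ∀ g ∈ Window θ.γ, ∀ (K k : ℕ) (X : (domSys (F.P K) M (k + 1)).Dom), ∀ φ ∈ sp K k X,
      ‖((S K) k).E (histPrefix g k) φ X‖ ≤ B * Real.exp (-(κE * (domSys (F.P K) M (k + 1)).dj X)))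
    (h238 : ∀ K k, ((S K) k).Bound238 (box θ.γ k) (sp K k) A R) (hAn : ∀ K k, ((S K) k).AnalyticH (box θ.γ k) (sp K k))
    (Ec : ℕ → ℕ → Type*) [∀ K k, NormedAddCommGroup (Ec K k)] [∀ K k, NormedSpace ℂ (Ec K k)]
    (ι : letI := θ.instVβ₁; letI := θ.instVβ₂
      (K k : ℕ) → (domSys (F.P K) M (k + 1)).Dom → ((Fin (F.P K).d → Site (F.P K) (k + 1) → θ.Vβ) →L[ℝ] Ec K k))
    (Φ : (K k : ℕ) → (domSys (F.P K) M (k + 1)).Dom → Ec K k → CPair (F.P K) 𝔸)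
    (U : (K k : ℕ) → (domSys (F.P K) M (k + 1)).Dom → Set (Ec K k)) (hU : ∀ K k X, IsOpen (U K k X)) (hrU : ∀ K k X, ball (0 : Ec K k) r ⊆ U K k X)
    (hΦhol : ∀ (K k : ℕ) (X : (domSys (F.P K) M (k + 1)).Dom), DifferentiableOn ℂ (Φ K k X) (U K k X))
    (hΦemb : letI := θ.instVβ₁; letI := θ.instVβ₂
      ∀ (K k : ℕ) (X : (domSys (F.P K) M (k + 1)).Dom) (Bf : Fin (F.P K).d → Site (F.P K) (k + 1) → θ.Vβ),
        Φ K k X (ι K k X Bf) = emb K k (fun l t => NormedSpace.exp (θ.ρ8 (Bf l t))))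
    (hΦsp : ∀ (K k : ℕ) (X : (domSys (F.P K) M (k + 1)).Dom), ∀ z ∈ U K k X, ∀ Z : (domSys (F.P K) M (k + 1)).Dom, Z.1 ⊆ X.1 → Φ K k X z ∈ sp K k Z)
    (w : (K k : ℕ) → (domSys (F.P K) M (k + 1)).Dom → Site (F.P K) (k + 1) → ℝ) (hw₀ : ∀ K k X t, 0 ≤ w K k X t)
    (hw : letI := θ.instVβ₁; letI := θ.instVβ₂; letI := θ.instιβ
      ∀ (K k : ℕ) (X : (domSys (F.P K) M (k + 1)).Dom) (l : Fin (F.P K).d) (t : Site (F.P K) (k + 1)) (cc : θ.ιβ),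
        ‖ι K k X (Pi.single l (Pi.single t (θ.bV cc)))‖ ≤ w K k X t)
    (htail : ∀ (K k : ℕ) (X : (domSys (F.P K) M (k + 1)).Dom) (t : Site (F.P K) (k + 1)),
      let e : Site (F.P K) (k + 1) → TPt 4 (domCount (F.P K) M (k + 1) * M) := fun x i => (ZMod.cast (x i) : ZMod (domCount (F.P K) M (k + 1) * M))
      w K k X t ≤ B₃ * Real.exp (-δ₀ * distCT (domCount (F.P K) M (k + 1)) M (e t) (nearT (M := M) (e t) X)))
    (hκ₅ : delta1 δ₀ κ ((M : ℝ) * 4) ≤ κ₅) (hω : 0 < ℓ.ω) (hθω : ℓ.θ₅ ≤ ℓ.ω ^ 2) (hℓκ : ℓ.κ ≤ delta1 δ₀ κ ((M : ℝ) * 4))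
    (hC₉ : (4 * (2 * C₅ / (1 - ℓ.θ₅) + 2 * ((16 * B * B₃ ^ 2 / r ^ 2) * Real.exp (delta1 δ₀ κ ((M : ℝ) * 4) * ((M : ℝ) * 4) * 3) * K₀ (4 * 2 ^ 4) (2 * 4) * K₁ 4 (δ₀ / 2))) / θ.γ +
        ((16 * ((6 * c ^ 2 + 32 * c + 64) / c ^ 2 * B'') * B₃ ^ 2 / r ^ 2) * Real.exp (delta1 δ₀ κ ((M : ℝ) * 4) * ((M : ℝ) * 4) * 3) * K₀ (4 * 2 ^ 4) (2 * 4) *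
          K₁ 4 (δ₀ / 2)) * θ.γ / 2) / ℓ.ω ≤ ℓ.C₉) :
    NE9 ((objectsOfRecord₁₃ F N θ ℓ).EA 0) (Window θ.γ) ℓ.κ ℓ.moduli :=
  ne9_EA_objectsOfRecord₁₃_of_kernelStepRate_sectorHolo F N θ ℓ hs hγ hlim hC₅ h5 m' M hM S emb hloc sp hc hB'' hκ₀ hδ₀ hB₃ hr hB hκE hLsec hbd Ec ι Φ U hU hrU
    (differentiableOn_E_comp_of_printedSlots F S sp hA hr₁ hrate hsmall h238 hAn Ec Φ U hU hΦhol hΦsp)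
    hΦemb (ball_mem_sp_of_spaceClause F sp Ec Φ U hrU hΦsp) w hw₀ hw htail hκ₅ hω hθω hℓκ hC₉

open Classical in
/-- ★★★ **THE N22 PIN FACE — SECTOR EDITION, PRINT-LEVEL** — `N22At (rateCarriersOfRecord₁₃CoPH 𝔯 F θ hP g₀ os k).u3` for EVERY `k` under `hpin`: §1's
`ne9_EA_objectsOfRecord₁₃_of_kernelStepRate_sectorHolo_analyticH` at `θ.toStage13Params` fed to dag-n22-w3's `n22At_rateCarriers_of_kernels_pin_of_ne9`.  «N18's kernel step rate +
SECTOR holomorphy with quadratic vanishing at zero coupling + printed (1.18) + printed (2.38) + printed configuration analyticity + holomorphic minimizer readings + p. 282 tails + law +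
(1.21) + letter rows ⇒ `N22At` with the record's geometric moduli, every run length».  LOCATED (hypothesis form); N22 NOT discharged. -/
theorem n22At_rateCarriers_of_kernels_pin_of_kernelStepRate_sectorHolo_analyticH (𝔯 : RateReading₁₃CoPH N) (θ : Stage13HParams F N) (hP : θ.Provisos₁₃CoPH F N)
    (g₀ : ℕ → ℝ) (os : List (ULoop F)) (ℓ : U3Letters₁₁) (hs : ℓ.Signs) (hγ : 0 < θ.γ)
    (hpin : (𝔯.lit F θ hP g₀ os).u3 = objectsOfRecord₁₃ F N θ.toStage13Params ℓ)
    (hlim : PolLimitsExistOfRecord₁₃ F N θ.toStage13Params) {κ₅ C₅ : ℝ} (hC₅ : 0 ≤ C₅) (h5 : KernelStepRateOfRecord₁₃ F N θ.toStage13Params κ₅ ℓ.θ₅ C₅)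
    {𝔸 : Type*} [NormedRing 𝔸] [NormedAlgebra ℂ 𝔸] (m' : ℕ) (M : ℕ) [NeZero M] (hM : M = F.L ^ m')
    (S : (K : ℕ) → ClusterTower (F.P K) 𝔸 M) (emb : ReadingMaps F (MatA N) 𝔸) (hloc : Localizes17OfRecord₁₃ F N θ.toStage13Params S emb)
    (sp : (K k : ℕ) → (domSys (F.P K) M (k + 1)).Dom → Set (CPair (F.P K) 𝔸))
    {κ κE δ₀ B₃ r c B'' B A R r₁ : ℝ} (hc : 0 < c) (hB'' : 0 ≤ B'')
    (hA : 0 ≤ A) (hr₁ : 0 ≤ r₁) (hrate : r₁ + 2 * (64 * Real.log 162) + 2 ≤ R) (hsmall : A * Real.exp (5 * r₁ + 1) * K₀ 64 8 * 9 * 64 ≤ 1)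
    (hκ₀ : kappa₀ (4 * 2 ^ 4) (2 * 4) ≤ κ / 2) (hδ₀ : 0 < δ₀) (hB₃ : 0 ≤ B₃) (hr : 0 < r) (hB : 0 ≤ B) (hκE : κ ≤ κE)
    (hLsec : ∀ (K k : ℕ) (i : Fin (k + 1)), ∀ g ∈ box θ.γ k, ∀ (X : (domSys (F.P K) M (k + 1)).Dom), ∀ φ ∈ sp K k X,
      ∃ (Ec : ℂ → ℂ) (O : Set ℂ) (Vc : ℂ), DifferentiableOn ℂ Ec O ∧ (∀ s ∈ Ioc (0 : ℝ) θ.γ, closedBall (s : ℂ) (c * s) ⊆ O) ∧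
        (∀ s ∈ Ioc (0 : ℝ) θ.γ, ∀ z ∈ closedBall (s : ℂ) (c * s), ‖Ec z - Vc‖ ≤ B'' * Real.exp (-(κE * (domSys (F.P K) M (k + 1)).dj X)) * s ^ 2) ∧
        (∀ t ∈ Ioc (0 : ℝ) θ.γ, Ec t = ((S K) k).E (Function.update g i t) φ X))
    (hbd : ∀ g ∈ Window θ.γ, ∀ (K k : ℕ) (X : (domSys (F.P K) M (k + 1)).Dom), ∀ φ ∈ sp K k X,
      ‖((S K) k).E (histPrefix g k) φ X‖ ≤ B * Real.exp (-(κE * (domSys (F.P K) M (k + 1)).dj X)))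
    (h238 : ∀ K k, ((S K) k).Bound238 (box θ.γ k) (sp K k) A R) (hAn : ∀ K k, ((S K) k).AnalyticH (box θ.γ k) (sp K k))
    (Ec : ℕ → ℕ → Type*) [∀ K k, NormedAddCommGroup (Ec K k)] [∀ K k, NormedSpace ℂ (Ec K k)]
    (ι : letI := θ.instVβ₁; letI := θ.instVβ₂
      (K k : ℕ) → (domSys (F.P K) M (k + 1)).Dom → ((Fin (F.P K).d → Site (F.P K) (k + 1) → θ.Vβ) →L[ℝ] Ec K k))
    (Φ : (K k : ℕ) → (domSys (F.P K) M (k + 1)).Dom → Ec K k → CPair (F.P K) 𝔸)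
    (U : (K k : ℕ) → (domSys (F.P K) M (k + 1)).Dom → Set (Ec K k)) (hU : ∀ K k X, IsOpen (U K k X)) (hrU : ∀ K k X, ball (0 : Ec K k) r ⊆ U K k X)
    (hΦhol : ∀ (K k : ℕ) (X : (domSys (F.P K) M (k + 1)).Dom), DifferentiableOn ℂ (Φ K k X) (U K k X))
    (hΦemb : letI := θ.instVβ₁; letI := θ.instVβ₂
      ∀ (K k : ℕ) (X : (domSys (F.P K) M (k + 1)).Dom) (Bf : Fin (F.P K).d → Site (F.P K) (k + 1) → θ.Vβ),
        Φ K k X (ι K k X Bf) = emb K k (fun l t => NormedSpace.exp (θ.ρ8 (Bf l t))))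
    (hΦsp : ∀ (K k : ℕ) (X : (domSys (F.P K) M (k + 1)).Dom), ∀ z ∈ U K k X, ∀ Z : (domSys (F.P K) M (k + 1)).Dom, Z.1 ⊆ X.1 → Φ K k X z ∈ sp K k Z)
    (w : (K k : ℕ) → (domSys (F.P K) M (k + 1)).Dom → Site (F.P K) (k + 1) → ℝ) (hw₀ : ∀ K k X t, 0 ≤ w K k X t)
    (hw : letI := θ.instVβ₁; letI := θ.instVβ₂; letI := θ.instιβ
      ∀ (K k : ℕ) (X : (domSys (F.P K) M (k + 1)).Dom) (l : Fin (F.P K).d) (t : Site (F.P K) (k + 1)) (cc : θ.ιβ),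
        ‖ι K k X (Pi.single l (Pi.single t (θ.bV cc)))‖ ≤ w K k X t)
    (htail : ∀ (K k : ℕ) (X : (domSys (F.P K) M (k + 1)).Dom) (t : Site (F.P K) (k + 1)),
      let e : Site (F.P K) (k + 1) → TPt 4 (domCount (F.P K) M (k + 1) * M) := fun x i => (ZMod.cast (x i) : ZMod (domCount (F.P K) M (k + 1) * M))
      w K k X t ≤ B₃ * Real.exp (-δ₀ * distCT (domCount (F.P K) M (k + 1)) M (e t) (nearT (M := M) (e t) X)))
    (hκ₅ : delta1 δ₀ κ ((M : ℝ) * 4) ≤ κ₅) (hω : 0 < ℓ.ω) (hθω : ℓ.θ₅ ≤ ℓ.ω ^ 2) (hℓκ : ℓ.κ ≤ delta1 δ₀ κ ((M : ℝ) * 4))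
    (hC₉ : (4 * (2 * C₅ / (1 - ℓ.θ₅) + 2 * ((16 * B * B₃ ^ 2 / r ^ 2) * Real.exp (delta1 δ₀ κ ((M : ℝ) * 4) * ((M : ℝ) * 4) * 3) * K₀ (4 * 2 ^ 4) (2 * 4) * K₁ 4 (δ₀ / 2))) / θ.γ +
        ((16 * ((6 * c ^ 2 + 32 * c + 64) / c ^ 2 * B'') * B₃ ^ 2 / r ^ 2) * Real.exp (delta1 δ₀ κ ((M : ℝ) * 4) * ((M : ℝ) * 4) * 3) * K₀ (4 * 2 ^ 4) (2 * 4) *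
          K₁ 4 (δ₀ / 2)) * θ.γ / 2) / ℓ.ω ≤ ℓ.C₉) (k : ℕ) :
    N22At (rateCarriersOfRecord₁₃CoPH 𝔯 F θ hP g₀ os k).u3 :=
  n22At_rateCarriers_of_kernels_pin_of_ne9 𝔯 θ hP g₀ os ℓ hs hpin
    (ne9_EA_objectsOfRecord₁₃_of_kernelStepRate_sectorHolo_analyticH F N θ.toStage13Params ℓ hs hγ hlim hC₅ h5 m' M hM S emb hloc sp hc hB'' hA hr₁ hrate hsmall hκ₀ hδ₀
      hB₃ hr hB hκE hLsec hbd h238 hAn Ec ι Φ U hU hrU hΦhol hΦemb hΦsp w hw₀ hw htail hκ₅ hω hθω hℓκ hC₉) k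

/-! ## §2 … with the (1.21) existence letter DISCHARGED by (G≈) (dag-n22-w3 g4's p616912 §3) -/

open Classical in
/-- ★★★ **K3's `h9`, SECTOR EDITION, PRINT-LEVEL + (G≈)** — §1 with `hlim := polLimitsExistOfRecord₁₃_of_twoPointGenerating …` (p616912 §3; its `hHhol` from the SAME PRINTED `AnalyticH` + the
SAME holomorphic readings by J32′ §1; numerals `0 < κ ≤ r₁`, `κ₀(64,8) ≤ κ∕4`): … + the small∕near class `lo` with its threshold clause + (G≈) on the bidisc `‖σ‖ < r₂` at rate
`0 ≤ r₀ < 1` ⟹ `NE9 ((objectsOfRecord₁₃ F N θ ℓ).EA 0) (Window θ.γ) ℓ.κ ℓ.moduli`.  NO (1.21)-existence and NO term-holomorphy hypothesis displayed.  LOCATED (hypothesis form);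
N22 NOT discharged. -/
theorem ne9_EA_objectsOfRecord₁₃_of_kernelStepRate_sectorHolo_analyticH_twoPointGenerating (θ : Stage13Params F N) (ℓ : U3Letters₁₁) (hs : ℓ.Signs) (hγ : 0 < θ.γ)
    {κ₅ C₅ : ℝ} (hC₅ : 0 ≤ C₅) (h5 : KernelStepRateOfRecord₁₃ F N θ κ₅ ℓ.θ₅ C₅)
    {𝔸 : Type*} [NormedRing 𝔸] [NormedAlgebra ℂ 𝔸] (m' : ℕ) (M : ℕ) [NeZero M] (hM : M = F.L ^ m')
    (S : (K : ℕ) → ClusterTower (F.P K) 𝔸 M) (emb : ReadingMaps F (MatA N) 𝔸) (hloc : Localizes17OfRecord₁₃ F N θ S emb)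
    (sp : (K k : ℕ) → (domSys (F.P K) M (k + 1)).Dom → Set (CPair (F.P K) 𝔸))
    {κ κE δ₀ B₃ r c B'' B A R r₁ r₂ r₀ : ℝ} (hc : 0 < c) (hB'' : 0 ≤ B'')
    (hA : 0 ≤ A) (hr₁ : 0 ≤ r₁) (hrate : r₁ + 2 * (64 * Real.log 162) + 2 ≤ R) (hsmall : A * Real.exp (5 * r₁ + 1) * K₀ 64 8 * 9 * 64 ≤ 1)
    (hκ0 : 0 < κ) (hκr : κ ≤ r₁) (hκ4 : kappa₀ (4 * 2 ^ 4) (2 * 4) ≤ κ / 2 / 2) (hδ₀ : 0 < δ₀) (hB₃ : 0 ≤ B₃) (hr : 0 < r) (hB : 0 ≤ B) (hκE : κ ≤ κE)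
    (hLsec : ∀ (K k : ℕ) (i : Fin (k + 1)), ∀ g ∈ box θ.γ k, ∀ (X : (domSys (F.P K) M (k + 1)).Dom), ∀ φ ∈ sp K k X,
      ∃ (Ec : ℂ → ℂ) (O : Set ℂ) (Vc : ℂ), DifferentiableOn ℂ Ec O ∧ (∀ s ∈ Ioc (0 : ℝ) θ.γ, closedBall (s : ℂ) (c * s) ⊆ O) ∧
        (∀ s ∈ Ioc (0 : ℝ) θ.γ, ∀ z ∈ closedBall (s : ℂ) (c * s), ‖Ec z - Vc‖ ≤ B'' * Real.exp (-(κE * (domSys (F.P K) M (k + 1)).dj X)) * s ^ 2) ∧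
        (∀ t ∈ Ioc (0 : ℝ) θ.γ, Ec t = ((S K) k).E (Function.update g i t) φ X))
    (hbd : ∀ g ∈ Window θ.γ, ∀ (K k : ℕ) (X : (domSys (F.P K) M (k + 1)).Dom), ∀ φ ∈ sp K k X,
      ‖((S K) k).E (histPrefix g k) φ X‖ ≤ B * Real.exp (-(κE * (domSys (F.P K) M (k + 1)).dj X)))
    (h238 : ∀ K k, ((S K) k).Bound238 (box θ.γ k) (sp K k) A R) (hAn : ∀ K k, ((S K) k).AnalyticH (box θ.γ k) (sp K k))
    (Ec : ℕ → ℕ → Type*) [∀ K k, NormedAddCommGroup (Ec K k)] [∀ K k, NormedSpace ℂ (Ec K k)]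
    (ι : letI := θ.instVβ₁; letI := θ.instVβ₂
      (K k : ℕ) → (domSys (F.P K) M (k + 1)).Dom → ((Fin (F.P K).d → Site (F.P K) (k + 1) → θ.Vβ) →L[ℝ] Ec K k))
    (Φ : (K k : ℕ) → (domSys (F.P K) M (k + 1)).Dom → Ec K k → CPair (F.P K) 𝔸)
    (U : (K k : ℕ) → (domSys (F.P K) M (k + 1)).Dom → Set (Ec K k)) (hU : ∀ K k X, IsOpen (U K k X)) (hrU : ∀ K k X, ball (0 : Ec K k) r ⊆ U K k X)
    (hΦhol : ∀ (K k : ℕ) (X : (domSys (F.P K) M (k + 1)).Dom), DifferentiableOn ℂ (Φ K k X) (U K k X))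
    (hΦemb : letI := θ.instVβ₁; letI := θ.instVβ₂
      ∀ (K k : ℕ) (X : (domSys (F.P K) M (k + 1)).Dom) (Bf : Fin (F.P K).d → Site (F.P K) (k + 1) → θ.Vβ),
        Φ K k X (ι K k X Bf) = emb K k (fun l t => NormedSpace.exp (θ.ρ8 (Bf l t))))
    (hΦsp : ∀ (K k : ℕ) (X : (domSys (F.P K) M (k + 1)).Dom), ∀ z ∈ U K k X, ∀ Z : (domSys (F.P K) M (k + 1)).Dom, Z.1 ⊆ X.1 → Φ K k X z ∈ sp K k Z)
    (w : (K k : ℕ) → (domSys (F.P K) M (k + 1)).Dom → Site (F.P K) (k + 1) → ℝ) (hw₀ : ∀ K k X t, 0 ≤ w K k X t)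
    (hw : letI := θ.instVβ₁; letI := θ.instVβ₂; letI := θ.instιβ
      ∀ (K k : ℕ) (X : (domSys (F.P K) M (k + 1)).Dom) (l : Fin (F.P K).d) (t : Site (F.P K) (k + 1)) (cc : θ.ιβ),
        ‖ι K k X (Pi.single l (Pi.single t (θ.bV cc)))‖ ≤ w K k X t)
    (htail : ∀ (K k : ℕ) (X : (domSys (F.P K) M (k + 1)).Dom) (t : Site (F.P K) (k + 1)),
      let e : Site (F.P K) (k + 1) → TPt 4 (domCount (F.P K) M (k + 1) * M) := fun x i => (ZMod.cast (x i) : ZMod (domCount (F.P K) M (k + 1) * M))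
      w K k X t ≤ B₃ * Real.exp (-δ₀ * distCT (domCount (F.P K) M (k + 1)) M (e t) (nearT (M := M) (e t) X)))
    (lo : (k K : ℕ) → (domSys (F.P K) M (k + 1)).Dom → Prop) [∀ k K, DecidablePred (lo k K)]
    (hlo : ∀ (k K : ℕ) (X : (domSys (F.P K) M (k + 1)).Dom), ¬ lo k K X →
      let e : Site (F.P K) (k + 1) → TPt 4 (domCount (F.P K) M (k + 1) * M) := fun x i => (ZMod.cast (x i) : ZMod (domCount (F.P K) M (k + 1) * M))
      (K : ℝ) ≤ torusTreeLen X.1 ∨ (K : ℝ) ≤ distCT (domCount (F.P K) M (k + 1)) M (e (siteOfInt F K (k + 1) 0)) (nearT (M := M) (e (siteOfInt F K (k + 1) 0)) X))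
    (hr₀ : r₀ < 1) (hr₀' : 0 ≤ r₀) (hr₂ : 0 < r₂) (hr₂r : (2 * B₃ + 1) * r₂ ≤ r)
    (hG : letI := θ.instVβ₁; letI := θ.instVβ₂; letI := θ.instιβ
      ∀ g ∈ Window θ.γ, ∀ (k : ℕ) (μ ν : Fin 4) (z : Fin 4 → ℤ), ∃ (K₀ : ℕ) (C : ℝ), ∀ K : ℕ, K₀ ≤ K → ∀ (cc : θ.ιβ) (σ : Fin 2 → ℂ), ‖σ‖ < r₂ →
      ‖∑ X ∈ Finset.univ.filter (lo k (K + 1)), ((S (K + 1)) k).E (histPrefix g k) (Φ (K + 1) k X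
          (σ 0 • ι (K + 1) k X (Pi.single (Fin.cast (F.P_d (K + 1)).symm μ) (Pi.single (siteOfInt F (K + 1) (k + 1) z) (θ.bV cc))) +
           σ 1 • ι (K + 1) k X (Pi.single (Fin.cast (F.P_d (K + 1)).symm ν) (Pi.single (siteOfInt F (K + 1) (k + 1) 0) (θ.bV cc))))) X -
        ∑ X ∈ Finset.univ.filter (lo k K), ((S K) k).E (histPrefix g k) (Φ K k X
          (σ 0 • ι K k X (Pi.single (Fin.cast (F.P_d K).symm μ) (Pi.single (siteOfInt F K (k + 1) z) (θ.bV cc))) +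
           σ 1 • ι K k X (Pi.single (Fin.cast (F.P_d K).symm ν) (Pi.single (siteOfInt F K (k + 1) 0) (θ.bV cc))))) X‖ ≤ C * r₀ ^ K)
    (hκ₅ : delta1 δ₀ κ ((M : ℝ) * 4) ≤ κ₅) (hω : 0 < ℓ.ω) (hθω : ℓ.θ₅ ≤ ℓ.ω ^ 2) (hℓκ : ℓ.κ ≤ delta1 δ₀ κ ((M : ℝ) * 4))
    (hC₉ : (4 * (2 * C₅ / (1 - ℓ.θ₅) + 2 * ((16 * B * B₃ ^ 2 / r ^ 2) * Real.exp (delta1 δ₀ κ ((M : ℝ) * 4) * ((M : ℝ) * 4) * 3) * K₀ (4 * 2 ^ 4) (2 * 4) * K₁ 4 (δ₀ / 2))) / θ.γ +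
        ((16 * ((6 * c ^ 2 + 32 * c + 64) / c ^ 2 * B'') * B₃ ^ 2 / r ^ 2) * Real.exp (delta1 δ₀ κ ((M : ℝ) * 4) * ((M : ℝ) * 4) * 3) * K₀ (4 * 2 ^ 4) (2 * 4) *
          K₁ 4 (δ₀ / 2)) * θ.γ / 2) / ℓ.ω ≤ ℓ.C₉) :
    NE9 ((objectsOfRecord₁₃ F N θ ℓ).EA 0) (Window θ.γ) ℓ.κ ℓ.moduli :=
  ne9_EA_objectsOfRecord₁₃_of_kernelStepRate_sectorHolo_analyticH F N θ ℓ hs hγ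
    (polLimitsExistOfRecord₁₃_of_twoPointGenerating F N θ m' hM S emb hloc (fun _ k => box θ.γ k) (fun _ hg _ k => histPrefix_mem_box hg k) sp
      hA hr₁ hκ0 hκr hκ4 hrate hsmall hB₃ hδ₀ hr h238 Ec ι Φ U hU hrU
      (fun K k _ hh X Z hZ => differentiableOn_H_comp_of_analyticH ((S K) k) (box θ.γ k) (sp K k) (hAn K k) hh (Φ K k X) (hΦhol K k X) X (hΦsp K k X) Z hZ)
      hΦemb hΦsp w hw₀ hw htail lo hlo hr₀ hr₀' hr₂ hr₂r hG)
    hC₅ h5 m' M hM S emb hloc sp hc hB'' hA hr₁ hrate hsmall (by linarith) hδ₀ hB₃ hr hB hκE hLsec hbd h238 hAn Ec ι Φ U hU hrU hΦhol hΦemb hΦsp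
    w hw₀ hw htail hκ₅ hω hθω hℓκ hC₉

open Classical in
/-- ★★★ **THE N22 PIN FACE — SECTOR EDITION, PRINT-LEVEL + (G≈)** — `N22At (rateCarriersOfRecord₁₃CoPH 𝔯 F θ hP g₀ os k).u3` for EVERY `k` under `hpin`: §2's
`ne9_EA_objectsOfRecord₁₃_of_kernelStepRate_sectorHolo_analyticH_twoPointGenerating` at `θ.toStage13Params` fed to dag-n22-w3's `n22At_rateCarriers_of_kernels_pin_of_ne9`.  «N18's kernel
step rate + SECTOR holomorphy with quadratic vanishing at zero coupling + printed (1.18) + printed (2.38) + printed configuration analyticity + holomorphic minimizer readings + p. 282 tails +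
(G≈) + law + letter rows ⇒ `N22At` with the record's geometric moduli, every run length».  LOCATED (hypothesis form); N22 NOT discharged. -/
theorem n22At_rateCarriers_of_kernels_pin_of_kernelStepRate_sectorHolo_analyticH_twoPointGenerating (𝔯 : RateReading₁₃CoPH N) (θ : Stage13HParams F N)
    (hP : θ.Provisos₁₃CoPH F N) (g₀ : ℕ → ℝ) (os : List (ULoop F)) (ℓ : U3Letters₁₁) (hs : ℓ.Signs) (hγ : 0 < θ.γ)
    (hpin : (𝔯.lit F θ hP g₀ os).u3 = objectsOfRecord₁₃ F N θ.toStage13Params ℓ)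
    {κ₅ C₅ : ℝ} (hC₅ : 0 ≤ C₅) (h5 : KernelStepRateOfRecord₁₃ F N θ.toStage13Params κ₅ ℓ.θ₅ C₅)
    {𝔸 : Type*} [NormedRing 𝔸] [NormedAlgebra ℂ 𝔸] (m' : ℕ) (M : ℕ) [NeZero M] (hM : M = F.L ^ m')
    (S : (K : ℕ) → ClusterTower (F.P K) 𝔸 M) (emb : ReadingMaps F (MatA N) 𝔸) (hloc : Localizes17OfRecord₁₃ F N θ.toStage13Params S emb)
    (sp : (K k : ℕ) → (domSys (F.P K) M (k + 1)).Dom → Set (CPair (F.P K) 𝔸))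
    {κ κE δ₀ B₃ r c B'' B A R r₁ r₂ r₀ : ℝ} (hc : 0 < c) (hB'' : 0 ≤ B'')
    (hA : 0 ≤ A) (hr₁ : 0 ≤ r₁) (hrate : r₁ + 2 * (64 * Real.log 162) + 2 ≤ R) (hsmall : A * Real.exp (5 * r₁ + 1) * K₀ 64 8 * 9 * 64 ≤ 1)
    (hκ0 : 0 < κ) (hκr : κ ≤ r₁) (hκ4 : kappa₀ (4 * 2 ^ 4) (2 * 4) ≤ κ / 2 / 2) (hδ₀ : 0 < δ₀) (hB₃ : 0 ≤ B₃) (hr : 0 < r) (hB : 0 ≤ B) (hκE : κ ≤ κE)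
    (hLsec : ∀ (K k : ℕ) (i : Fin (k + 1)), ∀ g ∈ box θ.γ k, ∀ (X : (domSys (F.P K) M (k + 1)).Dom), ∀ φ ∈ sp K k X,
      ∃ (Ec : ℂ → ℂ) (O : Set ℂ) (Vc : ℂ), DifferentiableOn ℂ Ec O ∧ (∀ s ∈ Ioc (0 : ℝ) θ.γ, closedBall (s : ℂ) (c * s) ⊆ O) ∧
        (∀ s ∈ Ioc (0 : ℝ) θ.γ, ∀ z ∈ closedBall (s : ℂ) (c * s), ‖Ec z - Vc‖ ≤ B'' * Real.exp (-(κE * (domSys (F.P K) M (k + 1)).dj X)) * s ^ 2) ∧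
        (∀ t ∈ Ioc (0 : ℝ) θ.γ, Ec t = ((S K) k).E (Function.update g i t) φ X))
    (hbd : ∀ g ∈ Window θ.γ, ∀ (K k : ℕ) (X : (domSys (F.P K) M (k + 1)).Dom), ∀ φ ∈ sp K k X,
      ‖((S K) k).E (histPrefix g k) φ X‖ ≤ B * Real.exp (-(κE * (domSys (F.P K) M (k + 1)).dj X)))
    (h238 : ∀ K k, ((S K) k).Bound238 (box θ.γ k) (sp K k) A R) (hAn : ∀ K k, ((S K) k).AnalyticH (box θ.γ k) (sp K k))
    (Ec : ℕ → ℕ → Type*) [∀ K k, NormedAddCommGroup (Ec K k)] [∀ K k, NormedSpace ℂ (Ec K k)]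
    (ι : letI := θ.instVβ₁; letI := θ.instVβ₂
      (K k : ℕ) → (domSys (F.P K) M (k + 1)).Dom → ((Fin (F.P K).d → Site (F.P K) (k + 1) → θ.Vβ) →L[ℝ] Ec K k))
    (Φ : (K k : ℕ) → (domSys (F.P K) M (k + 1)).Dom → Ec K k → CPair (F.P K) 𝔸)
    (U : (K k : ℕ) → (domSys (F.P K) M (k + 1)).Dom → Set (Ec K k)) (hU : ∀ K k X, IsOpen (U K k X)) (hrU : ∀ K k X, ball (0 : Ec K k) r ⊆ U K k X)
    (hΦhol : ∀ (K k : ℕ) (X : (domSys (F.P K) M (k + 1)).Dom), DifferentiableOn ℂ (Φ K k X) (U K k X))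
    (hΦemb : letI := θ.instVβ₁; letI := θ.instVβ₂
      ∀ (K k : ℕ) (X : (domSys (F.P K) M (k + 1)).Dom) (Bf : Fin (F.P K).d → Site (F.P K) (k + 1) → θ.Vβ),
        Φ K k X (ι K k X Bf) = emb K k (fun l t => NormedSpace.exp (θ.ρ8 (Bf l t))))
    (hΦsp : ∀ (K k : ℕ) (X : (domSys (F.P K) M (k + 1)).Dom), ∀ z ∈ U K k X, ∀ Z : (domSys (F.P K) M (k + 1)).Dom, Z.1 ⊆ X.1 → Φ K k X z ∈ sp K k Z)
    (w : (K k : ℕ) → (domSys (F.P K) M (k + 1)).Dom → Site (F.P K) (k + 1) → ℝ) (hw₀ : ∀ K k X t, 0 ≤ w K k X t)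
    (hw : letI := θ.instVβ₁; letI := θ.instVβ₂; letI := θ.instιβ
      ∀ (K k : ℕ) (X : (domSys (F.P K) M (k + 1)).Dom) (l : Fin (F.P K).d) (t : Site (F.P K) (k + 1)) (cc : θ.ιβ),
        ‖ι K k X (Pi.single l (Pi.single t (θ.bV cc)))‖ ≤ w K k X t)
    (htail : ∀ (K k : ℕ) (X : (domSys (F.P K) M (k + 1)).Dom) (t : Site (F.P K) (k + 1)),
      let e : Site (F.P K) (k + 1) → TPt 4 (domCount (F.P K) M (k + 1) * M) := fun x i => (ZMod.cast (x i) : ZMod (domCount (F.P K) M (k + 1) * M))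
      w K k X t ≤ B₃ * Real.exp (-δ₀ * distCT (domCount (F.P K) M (k + 1)) M (e t) (nearT (M := M) (e t) X)))
    (lo : (k K : ℕ) → (domSys (F.P K) M (k + 1)).Dom → Prop) [∀ k K, DecidablePred (lo k K)]
    (hlo : ∀ (k K : ℕ) (X : (domSys (F.P K) M (k + 1)).Dom), ¬ lo k K X →
      let e : Site (F.P K) (k + 1) → TPt 4 (domCount (F.P K) M (k + 1) * M) := fun x i => (ZMod.cast (x i) : ZMod (domCount (F.P K) M (k + 1) * M))
      (K : ℝ) ≤ torusTreeLen X.1 ∨ (K : ℝ) ≤ distCT (domCount (F.P K) M (k + 1)) M (e (siteOfInt F K (k + 1) 0)) (nearT (M := M) (e (siteOfInt F K (k + 1) 0)) X))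
    (hr₀ : r₀ < 1) (hr₀' : 0 ≤ r₀) (hr₂ : 0 < r₂) (hr₂r : (2 * B₃ + 1) * r₂ ≤ r)
    (hG : letI := θ.instVβ₁; letI := θ.instVβ₂; letI := θ.instιβ
      ∀ g ∈ Window θ.γ, ∀ (k : ℕ) (μ ν : Fin 4) (z : Fin 4 → ℤ), ∃ (K₀ : ℕ) (C : ℝ), ∀ K : ℕ, K₀ ≤ K → ∀ (cc : θ.ιβ) (σ : Fin 2 → ℂ), ‖σ‖ < r₂ →
      ‖∑ X ∈ Finset.univ.filter (lo k (K + 1)), ((S (K + 1)) k).E (histPrefix g k) (Φ (K + 1) k X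
          (σ 0 • ι (K + 1) k X (Pi.single (Fin.cast (F.P_d (K + 1)).symm μ) (Pi.single (siteOfInt F (K + 1) (k + 1) z) (θ.bV cc))) +
           σ 1 • ι (K + 1) k X (Pi.single (Fin.cast (F.P_d (K + 1)).symm ν) (Pi.single (siteOfInt F (K + 1) (k + 1) 0) (θ.bV cc))))) X -
        ∑ X ∈ Finset.univ.filter (lo k K), ((S K) k).E (histPrefix g k) (Φ K k X
          (σ 0 • ι K k X (Pi.single (Fin.cast (F.P_d K).symm μ) (Pi.single (siteOfInt F K (k + 1) z) (θ.bV cc))) +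
           σ 1 • ι K k X (Pi.single (Fin.cast (F.P_d K).symm ν) (Pi.single (siteOfInt F K (k + 1) 0) (θ.bV cc))))) X‖ ≤ C * r₀ ^ K)
    (hκ₅ : delta1 δ₀ κ ((M : ℝ) * 4) ≤ κ₅) (hω : 0 < ℓ.ω) (hθω : ℓ.θ₅ ≤ ℓ.ω ^ 2) (hℓκ : ℓ.κ ≤ delta1 δ₀ κ ((M : ℝ) * 4))
    (hC₉ : (4 * (2 * C₅ / (1 - ℓ.θ₅) + 2 * ((16 * B * B₃ ^ 2 / r ^ 2) * Real.exp (delta1 δ₀ κ ((M : ℝ) * 4) * ((M : ℝ) * 4) * 3) * K₀ (4 * 2 ^ 4) (2 * 4) * K₁ 4 (δ₀ / 2))) / θ.γ +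
        ((16 * ((6 * c ^ 2 + 32 * c + 64) / c ^ 2 * B'') * B₃ ^ 2 / r ^ 2) * Real.exp (delta1 δ₀ κ ((M : ℝ) * 4) * ((M : ℝ) * 4) * 3) * K₀ (4 * 2 ^ 4) (2 * 4) *
          K₁ 4 (δ₀ / 2)) * θ.γ / 2) / ℓ.ω ≤ ℓ.C₉) (k : ℕ) :
    N22At (rateCarriersOfRecord₁₃CoPH 𝔯 F θ hP g₀ os k).u3 :=
  n22At_rateCarriers_of_kernels_pin_of_ne9 𝔯 θ hP g₀ os ℓ hs hpin
    (ne9_EA_objectsOfRecord₁₃_of_kernelStepRate_sectorHolo_analyticH_twoPointGenerating F N θ.toStage13Params ℓ hs hγ hC₅ h5 m' M hM S emb hloc sp hc hB'' hA hr₁ hrate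
      hsmall hκ0 hκr hκ4 hδ₀ hB₃ hr hB hκE hLsec hbd h238 hAn Ec ι Φ U hU hrU hΦhol hΦemb hΦsp w hw₀ hw htail lo hlo hr₀ hr₀' hr₂ hr₂r hG hκ₅ hω hθω hℓκ hC₉) k

end YMDAG.N22.AtRecordOfPrintedSlots

end
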